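import Literature.AlgebraicGeometry.Frobenioids.Thm36SubPerfectionUntrEquiv
import Literature.AlgebraicGeometry.Frobenioids.ArchimedeanRationallyStandard
import Literature.AlgebraicGeometry.Frobenioids.UnitTrivializationModelComparisonCanonical
import HarnessLib

/-!
# Frobenioids II, Thm. 3.6 (i): "`(C^Λ)^un-tr ⥲ C^ℝ`, compatible with the Frobenioid structures" — at THE
# categorical unit-trivialisation `(C^Λ)^un-tr` ([FrdI] Def. 3.1 (iv)), `Λ ∈ {ℤ, ℚ, ℝ}`

Mochizuki, *The geometry of Frobenioids II: poly-Frobenioids*, Kyushu J. Math. **62** (2008) 401–460, §3,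
Thm. 3.6 (i), kurims text p. 36: "For arbitrary `Λ`, there is a natural equivalence of categories
`(C^Λ)^un-tr ⥲ C^ℝ`, compatible with the Frobenioid structures" [cite: MochizukiFrdII2008, Thm 3.6 (i) p.36];
[FrdI] Def. 3.1 (iv) p. 57 ("the unit-trivialization `C^un-tr`": objects of `C^istr`, arrows modulo `O^×`) and
Prop. 3.3 (iv) p. 60 (its structure functor `C^un-tr → F_Φ`), Prop. 5.3 p. 103 ("`C^un-tr` … may be obtained as
the model Frobenioid associated to … `Φ` … and … `Φ^birat`").

PROOF-ONLY file (abc-iut cell, layer L1, row «M13-c7»; seat abc-iut-w5-d237, gen 4).  The slots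
`Thm36Sub.untrEquiv_Z` / `untrEquiv_R` (abc-iut-w4-d074, `Thm36SubModel.lean`, PROVED in
`Thm36SubModelProofs.lean`) and `untrEquiv_Q_holds` (abc-iut-w5-d237, `Thm36SubPerfectionUntrEquiv.lean`) read
`(C^Λ)^un-tr` in its MODEL DESCRIPTION `untrModel` ([FrdI] Prop. 5.3).  Here the same three equivalences are
stated for THE CATEGORICAL unit-trivialisation `(C^Λ)^un-tr := (C^Λ)^istr / ≈^{O^×}` of [FrdI] Def. 3.1 (iv)
(found's `PreFrobenioidData.Untr`) with ITS structure functor `C^un-tr → F_Φ` ([FrdI] Prop. 3.3 (iv),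
abc-iut-L1-d5's `PreFrobenioid.untrFunctor`), by transport along THE comparison equivalence
`C^un-tr ≌ untrModel` (abc-iut-L1-d5's `PreFrobenioid.untrComparison`, compatible with the functors to `F_Φ`:
`untrComparison_compToElem` — [FrdI] Prop. 5.3 / Thm. 5.2 (iv)):
* `Thm36i_untrEquiv_transport` — the generic transport of t9's predicate `Thm36i_untrEquiv FU FR` along an
  equivalence `U′ ≌ U` over the structure functors (pure category theory);
* `untrEquiv_Z_cat_holds` (`Λ = ℤ`, for `hF` : "`C` is a Frobenioid", Ex. 3.3 (ii)), `untrEquiv_Q_cat_holds`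
  (`Λ = ℚ`, `C^ℚ := C^pf`), `untrEquiv_R_cat_holds` (`Λ = ℝ`, `C^ℝ := C^rlf`, over a connected, totally epimorphic
  base — Ex. 3.3 (i)'s standing hypotheses, for the Frobenioid structure of `C^rlf`, w4-d074's
  `Thm36Sub.rlf_isFrobenioid`).
No definitions; no statement of the paper is strengthened or re-typed; nothing here bears on [IUTchIII] Cor. 3.12
(classical, refereed [FrdI]/[FrdII]); typed ≠ proved except where a `theorem` says so.
-/

noncomputable section

namespace Literature.AlgebraicGeometry.Frobenioids

open CategoryTheory Opposite Function Literature.AnabelianGeometry.EtaleTheta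
open scoped NNReal

universe w v v' u u' v₂ u₂ v₃ u₃ v₄ u₄

namespace ArchFrd

/-! ### Transport of `Thm36i_untrEquiv` along an equivalence over the structure functors -/

/-- **Transport of "`U ⥲ R` compatible with the Frobenioid structures"**: if `FU : U → F_Φ` and
`FR : R → F_Φ` are related by an equivalence over `F_Φ` (t9's `Thm36i_untrEquiv FU FR`) and `e₁ : U′ ≌ U`
satisfies `e₁ ⋙ FU ≅ FU′`, then so are `FU′` and `FR` (compose the equivalences and the isomorphisms).
[cite: MochizukiFrdII2008, Thm 3.6 (i) p.36] -/
theorem Thm36i_untrEquiv_transport {E : Type u} [Category.{v} E] {Φ : Eᵒᵖ ⥤ CommMonCat.{w}}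
    {U : Type u₂} [Category.{v₂} U] {U' : Type u₃} [Category.{v₃} U'] {R : Type u₄} [Category.{v₄} R]
    {FU : U ⥤ ElemFrobenioid Φ} {FU' : U' ⥤ ElemFrobenioid Φ} {FR : R ⥤ ElemFrobenioid Φ}
    (e₁ : U' ≌ U) (i : e₁.functor ⋙ FU ≅ FU') (h : Thm36i_untrEquiv FU FR) : Thm36i_untrEquiv FU' FR := by
  obtain ⟨e, ⟨j⟩⟩ := h
  exact ⟨e₁.trans e, ⟨Functor.associator _ _ _ ≪≫ Functor.isoWhiskerLeft e₁.functor j ≪≫ i⟩⟩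

variable {D : Type u} [Category.{v} D] (π : D ⥤ D0)

namespace Thm36Sub

/-! ### `Λ = ℤ` -/

/-- **Thm. 3.6 (i), "`(C^Λ)^un-tr ⥲ C^ℝ` compatible with the Frobenioid structures", `Λ = ℤ`, at THE categorical
unit-trivialisation** `C^un-tr` ([FrdI] Def. 3.1 (iv)) with its structure functor ([FrdI] Prop. 3.3 (iv),
`PreFrobenioid.untrFunctor hF`) read in `F_{Φ^rlf}` along `ι : Φ → Φ^rlf`: equivalent over `F_{Φ^rlf}` to `C^rlf`
— w4-d074's `untrEquiv_Z_holds` (model description) transported along abc-iut-L1-d5's comparison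
`untrComparison` ([FrdI] Prop. 5.3). `hF` : "`C` is a Frobenioid" (Ex. 3.3 (ii)).
[cite: MochizukiFrdII2008, Thm 3.6 (i) p.36] -/
theorem untrEquiv_Z_cat_holds (hF : PreFrobenioid.IsFrobenioid (C.toElem π)) :
    Thm36i_untrEquiv
      (PreFrobenioid.untrFunctor hF ⋙
        ElemFrobenioid.mapNatTrans
          (RealificationData.canonical (Φ π) (PreFrobenioid.IsPerfFactorialOn.op (isPerfFactorialOn_Φ π))).toRlf)
      (rlfStr π) := by
  obtain ⟨j⟩ := PreFrobenioid.untrComparison_compToElem (F := C.toElem π) hF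
  exact Thm36i_untrEquiv_transport (PreFrobenioid.untrComparison (C.toElem π) hF)
    ((Functor.associator _ _ _).symm ≪≫ Functor.isoWhiskerRight j _) (untrEquiv_Z_holds π)

/-! ### `Λ = ℚ` -/

/-- **Thm. 3.6 (i), "`(C^Λ)^un-tr ⥲ C^ℝ` compatible with the Frobenioid structures", `Λ = ℚ` (`C^ℚ := C^pf`), at
THE categorical unit-trivialisation** `(C^pf)^un-tr` with its structure functor read in `F_{Φ^rlf}` along
`Φ^pf → Φ^rlf`: equivalent over `F_{Φ^rlf}` to `C^rlf` — `untrEquiv_Q_holds` (model description) transported along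
`untrComparison` for the Frobenioid `C^pf` ([FrdI] Prop. 3.2 (iii) / Ex. 3.3 (ii), `C.pf_isFrobenioid`).
[cite: MochizukiFrdII2008, Thm 3.6 (i) p.36] -/
theorem untrEquiv_Q_cat_holds (hF : PreFrobenioid.IsFrobenioid (C.toElem π)) :
    Thm36i_untrEquiv
      (PreFrobenioid.untrFunctor (C.pf_isFrobenioid π hF) ⋙
        ElemFrobenioid.mapNatTrans
          (RealificationData.pfToRlfNatTrans (Φ π) (PreFrobenioid.IsPerfFactorialOn.op (isPerfFactorialOn_Φ π)) :
            (PreFrobenioid.Perfection.ops hF).monFunctor ⟶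
              rlfFunctor (Φ π) (PreFrobenioid.IsPerfFactorialOn.op (isPerfFactorialOn_Φ π))))
      (rlfStr π) := by
  obtain ⟨j⟩ := PreFrobenioid.untrComparison_compToElem (F := pfStr π hF) (C.pf_isFrobenioid π hF)
  exact Thm36i_untrEquiv_transport (PreFrobenioid.untrComparison (pfStr π hF) (C.pf_isFrobenioid π hF))
    ((Functor.associator _ _ _).symm ≪≫ Functor.isoWhiskerRight j _) (untrEquiv_Q_holds π hF)

/-! ### `Λ = ℝ` -/

/-- **Thm. 3.6 (i), "`(C^Λ)^un-tr ⥲ C^ℝ` compatible with the Frobenioid structures", `Λ = ℝ` (`C^ℝ := C^rlf`), at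
THE categorical unit-trivialisation** `(C^rlf)^un-tr` with its structure functor to `F_{Φ^rlf}`: equivalent over
`F_{Φ^rlf}` to `C^rlf` — w4-d074's `untrEquiv_R_holds` transported along `untrComparison` for the Frobenioid
`C^rlf` (over a connected, totally epimorphic base, `rlf_isFrobenioid`). [cite: MochizukiFrdII2008, Thm 3.6 (i) p.36] -/
theorem untrEquiv_R_cat_holds (hDc : IsGraphConnected D) (hDe : IsTotallyEpimorphic D) :
    Thm36i_untrEquiv (PreFrobenioid.untrFunctor (rlf_isFrobenioid π hDc hDe)) (rlfStr π) := by
  obtain ⟨j⟩ := PreFrobenioid.untrComparison_compToElem (F := rlfStr π) (rlf_isFrobenioid π hDc hDe)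
  exact Thm36i_untrEquiv_transport (PreFrobenioid.untrComparison (rlfStr π) (rlf_isFrobenioid π hDc hDe))
    j (untrEquiv_R_holds π)

end Thm36Sub

end ArchFrd

end Literature.AlgebraicGeometry.Frobenioids

end
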